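import Mathlib.Logic.Equiv.Fintype
import Literature.Computability.QuantumComplexity.ForrelationIdleWires
import Literature.Computability.Complexity.CircuitLightCone
import HarnessLib

/-!
# `k`-fold Forrelation under an injective relabelling of coordinates; read coordinates of a circuit

Topic `Literature/Computability/QuantumComplexity`; maths for the membership half
`AaronsonAmbainis2018_kForrelation_mem` of `aaronson_ambainis_kForrelation_complete`
(S. Aaronson, A. Ambainis, *Forrelation*, SIAM J. Comput. 47 (2018) = arXiv:1411.5729, §6 p. 26 with
§3.2, Prop. 6), continuing `ForrelationIdleWires.lean`. A polynomial-size quantum circuit deciding an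
explicit instance `(n, k, C₀, …, C_{k-1})` can only lay out the coordinates the circuits actually
READ (at most the code length, while `n` is written in binary), on query wires of its own choosing;
the functions it forrelates are therefore the pull-backs `x ↦ gᵢ (x ∘ e)` of the "read restrictions"
`gᵢ : {0,1}ˢ → {0,1}` along SOME injection `e : Fin s ↪ Fin W` of the read coordinates into the
wires, while the instance's own functions are the pull-backs along the inclusion `Fin s ↪ Fin n`.
This file proves what is needed to compare the two:

* **pull-back along an embedding** (`kForrelationValue_comp_embedding`): for `e : Fin s ↪ Fin n`,
  `Φ_{(gᵢ ∘ e^*)} = Φ_{g} · ρ_k^{n-s}` with the idle factor `ρ_k` of `ForrelationIdleWires.lean`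
  (`= 1` for odd `k`, `= 1/√2` for even `k`): extend `e` and the standard inclusion to a common
  permutation (`Equiv.Perm.exists_extending_pair`), then `kForrelationValue_comp_equiv` and
  `kForrelationValue_idle_pow`; corollaries for odd `k` (equality, `…_of_odd`), even `k`
  (`|Φ| ≤ 2^{-(n-s)/2}`, `…_of_even`) and two embeddings of the same `g` (`…_eq_of_odd`);
* **read coordinates** (`Circuit.readSet`: the input variables occurring as an argument wire of a
  gate or as the output wire; `Circuit.lightCone_subset_readSet`, `Circuit.eval_congr_readSet`:
  the value only depends on the read coordinates — from `Circuit.eval_congr_lightCone` of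
  `CircuitLightCone.lean`), and the factorisation of a function reading only `range e` through
  its read restriction (`eval_eq_readRestrict`).

## References

* S. Aaronson, A. Ambainis, *Forrelation: a problem that optimally separates quantum from
  classical computing*, SIAM J. Comput. 47 (2018) 982–1038; arXiv:1411.5729, §1.1.3, §3.2 (Fig. 2),
  §6 (p. 26) [AaronsonAmbainis2018].
* S. Bravyi, D. Gosset, R. König, *Quantum advantage with shallow circuits*, Science 362 (2018), §2
  (light cones) [BravyiGossetKonigScience2018].
-/

noncomputable section

/-! ### The coordinates read by a circuit -/

namespace Literature.Computability.Complexity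

open Finset

variable {ι : Type*} [DecidableEq ι]

/-- The input variable of a wire, as a set: `{i}` for an input wire `inl i`, `∅` for a gate
reference. [folklore] -/
def wireInputs : ι ⊕ ℕ → Finset ι
  | .inl i => {i}
  | .inr _ => ∅

/-- The input variables read by a gate: those occurring among its argument wires. [cite: AroraBarak2009, Def. 6.1] -/
def Gate.readSet (g : Gate ι) : Finset ι := univ.biUnion fun a => wireInputs (g.args a)

/-- The input variables read by a list of gates. [cite: AroraBarak2009, Def. 6.1] -/
def GateList.readSet (gs : List (Gate ι)) : Finset ι := (gs.map Gate.readSet).foldr (· ∪ ·) ∅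

/-- **The coordinates read by a circuit**: the input variables occurring as an argument wire of
some gate or as the output wire. [cite: AroraBarak2009, Def. 6.1] -/
def Circuit.readSet (C : Circuit ι) : Finset ι := GateList.readSet C.gates ∪ wireInputs C.output

omit [DecidableEq ι] in
/-- Membership in `wireInputs`. [folklore] -/
@[simp] theorem mem_wireInputs_iff [DecidableEq ι] {w : ι ⊕ ℕ} {i : ι} : i ∈ wireInputs w ↔ w = .inl i := by
  cases w <;> simp [wireInputs, eq_comm]

/-- Membership in the read set of a gate. [folklore] -/
theorem Gate.mem_readSet_iff {g : Gate ι} {i : ι} : i ∈ g.readSet ↔ ∃ a, g.args a = .inl i := by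
  simp [Gate.readSet]

/-- Membership in the read set of a gate list. [folklore] -/
theorem GateList.mem_readSet_iff {gs : List (Gate ι)} {i : ι} : i ∈ GateList.readSet gs ↔ ∃ g ∈ gs, i ∈ g.readSet := by
  induction gs with
  | nil => simp [GateList.readSet]
  | cons g gs ih =>
    simp only [GateList.readSet, List.map_cons, List.foldr_cons, Finset.mem_union] at ih ⊢
    rw [ih]
    simp

/-- The read set of a concatenation. [folklore] -/
theorem GateList.readSet_append (gs gs' : List (Gate ι)) :
    GateList.readSet (gs ++ gs') = GateList.readSet gs ∪ GateList.readSet gs' := by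
  ext i
  simp only [GateList.mem_readSet_iff, List.mem_append, Finset.mem_union]
  constructor
  · rintro ⟨g, hg | hg, hi⟩
    · exact Or.inl ⟨g, hg, hi⟩
    · exact Or.inr ⟨g, hg, hi⟩
  · rintro (⟨g, hg, hi⟩ | ⟨g, hg, hi⟩)
    · exact ⟨g, Or.inl hg, hi⟩
    · exact ⟨g, Or.inr hg, hi⟩

/-- Membership in the read set of a circuit. [folklore] -/
theorem Circuit.mem_readSet_iff {C : Circuit ι} {i : ι} :
    i ∈ C.readSet ↔ (∃ g ∈ C.gates, ∃ a, g.args a = .inl i) ∨ C.output = .inl i := by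
  simp [Circuit.readSet, GateList.mem_readSet_iff, Gate.mem_readSet_iff]

/-- Every dependency set of a program lies in its read set. [cite: BravyiGossetKonigScience2018, §2 Eq. (5)] -/
theorem GateList.deps_getD_subset_readSet (gs : List (Gate ι)) :
    ∀ m, (GateList.deps gs).getD m ∅ ⊆ GateList.readSet gs := by
  induction gs using List.reverseRecOn with
  | nil => intro m; simp [GateList.deps]
  | append_singleton gs g ih =>
    intro m
    rw [GateList.deps_append_singleton, GateList.readSet_append]
    rcases lt_or_ge m gs.length with h | h
    · rw [List.getD_append _ _ _ _ (by simpa using h)]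
      exact (ih m).trans Finset.subset_union_left
    · rw [List.getD_append_right _ _ _ _ (by simpa using h)]
      rcases Nat.lt_or_ge (m - gs.length) 1 with h1 | h1
      · have h0 : m - (GateList.deps gs).length = 0 := by simp; omega
        rw [h0, List.getD_cons_zero]
        intro i hi
        simp only [GateList.depOf, Finset.mem_biUnion, Finset.mem_univ, true_and] at hi
        obtain ⟨a, ha⟩ := hi
        cases hga : g.args a with
        | inl i' =>
          rw [hga] at ha
          simp only [Finset.mem_singleton] at ha
          subst ha
          refine Finset.mem_union_right _ ?_
          rw [GateList.mem_readSet_iff]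
          exact ⟨g, List.mem_singleton_self _, Gate.mem_readSet_iff.2 ⟨a, hga⟩⟩
        | inr m' =>
          rw [hga] at ha
          exact Finset.mem_union_left _ (ih m' ha)
      · rw [List.getD_eq_default _ _ (by simp; omega)]
        exact Finset.empty_subset _

/-- **The light cone lies in the read set.** [cite: BravyiGossetKonigScience2018, §2 Eq. (5)] -/
theorem Circuit.lightCone_subset_readSet (C : Circuit ι) : C.lightCone ⊆ C.readSet := by
  unfold Circuit.lightCone Circuit.readSet
  cases C.output with
  | inl i => intro j hj; simp only [Finset.mem_singleton] at hj; subst hj; simp [wireInputs]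
  | inr m => exact (GateList.deps_getD_subset_readSet C.gates m).trans Finset.subset_union_left

/-- **The value of a circuit only depends on the coordinates it reads.** [cite: AroraBarak2009, Def. 6.1] -/
theorem Circuit.eval_congr_readSet (C : Circuit ι) {x x' : ι → Bool} (h : ∀ i ∈ C.readSet, x i = x' i) :
    C.eval x = C.eval x' :=
  C.eval_congr_lightCone fun i hi => h i (C.lightCone_subset_readSet hi)

/-- The read set of a gate is bounded by its arity. [folklore] -/
theorem Gate.card_readSet_le (g : Gate ι) : g.readSet.card ≤ g.arity := by
  unfold Gate.readSet
  refine (Finset.card_biUnion_le).trans ?_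
  calc ∑ a : Fin g.arity, (wireInputs (g.args a)).card ≤ ∑ _a : Fin g.arity, 1 :=
        Finset.sum_le_sum fun a _ => by cases g.args a <;> simp [wireInputs]
    _ = g.arity := by simp

end Literature.Computability.Complexity

namespace Literature.Computability.QuantumComplexity

open Finset _root_.Literature.Computability.Complexity

variable {k s n t : ℕ}

/-! ### Pull-back of the functions along an embedding of the coordinates -/

/-- **Pull-back along an embedding, split form.** For `e : Fin s ↪ Fin (s + t)` and functions
`g₀, …, g_{k-1}` on `s` bits, the functions `x ↦ gᵢ (x ∘ e)` on `s + t` bits have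
`Φ = Φ_g · ρ_k^t`: a permutation of the coordinates carries `e` to the standard inclusion
(`Φ` is invariant, `kForrelationValue_comp_equiv`), after which the last `t` coordinates are idle
(`kForrelationValue_idle_pow`). [cite: AaronsonAmbainis2018, §1.1.3 and §3.2] -/
theorem kForrelationValue_comp_embedding_add (e : Fin s ↪ Fin (s + t)) (g : Fin k → (Fin s → Bool) → Bool) :
    kForrelationValue (n := s + t) (fun i x => g i (fun j => x (e j))) = kForrelationValue g * idleFactor k ^ t := by
  obtain ⟨σ, hσ⟩ := Equiv.Perm.exists_extending_pair (fun j : Fin s => Fin.castAdd t j) e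
    (Fin.castAdd_injective _ _) e.injective
  set F : Fin k → (Fin (s + t) → Bool) → Bool := fun i' x' => g i' fun j => x' (Fin.castAdd t j) with hF
  have key : (fun i (x : Fin (s + t) → Bool) => g i (fun j => x (e j))) = fun i y => F i (y ∘ σ) := by
    funext i y
    simp only [hF, Function.comp_apply, hσ]
  rw [key, kForrelationValue_comp_equiv σ F, hF]
  exact kForrelationValue_idle_pow g t

/-- **Pull-back along an embedding.** For `e : Fin s ↪ Fin n`, `Φ_{(gᵢ ∘ e^*)} = Φ_g · ρ_k^{n-s}`.
[cite: AaronsonAmbainis2018, §1.1.3 and §3.2] -/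
theorem kForrelationValue_comp_embedding (e : Fin s ↪ Fin n) (g : Fin k → (Fin s → Bool) → Bool) :
    kForrelationValue (fun i x => g i (fun j => x (e j))) = kForrelationValue g * idleFactor k ^ (n - s) := by
  have hs : s ≤ n := by simpa using Fintype.card_le_of_embedding e
  obtain ⟨t, rfl⟩ := Nat.exists_eq_add_of_le hs
  rw [Nat.add_sub_cancel_left]
  exact kForrelationValue_comp_embedding_add e g

/-- **Odd `k`: the pull-back does not change `Φ`.** [cite: AaronsonAmbainis2018, §3.2] -/
theorem kForrelationValue_comp_embedding_of_odd (hk : k % 2 = 1) (e : Fin s ↪ Fin n)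
    (g : Fin k → (Fin s → Bool) → Bool) :
    kForrelationValue (fun i x => g i (fun j => x (e j))) = kForrelationValue g := by
  rw [kForrelationValue_comp_embedding, idleFactor_of_odd hk, one_pow, mul_one]

/-- **Even `k`: `|Φ| ≤ 2^{-(n-s)/2}` for a pull-back along `Fin s ↪ Fin n`.** [cite: AaronsonAmbainis2018, §3.2] -/
theorem abs_kForrelationValue_comp_embedding_le_of_even (hk : k % 2 = 0) (e : Fin s ↪ Fin n)
    (g : Fin k → (Fin s → Bool) → Bool) :
    |kForrelationValue (fun i x => g i (fun j => x (e j)))| ≤ ((Real.sqrt 2)⁻¹) ^ (n - s) := by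
  rw [kForrelationValue_comp_embedding, idleFactor_of_even hk, abs_mul, abs_pow,
    abs_of_nonneg (inv_nonneg.2 (Real.sqrt_nonneg 2))]
  have h1 := abs_kForrelationValue_le_one g
  have h2 : 0 ≤ ((Real.sqrt 2)⁻¹) ^ (n - s) := by positivity
  calc |kForrelationValue g| * ((Real.sqrt 2)⁻¹) ^ (n - s) ≤ 1 * ((Real.sqrt 2)⁻¹) ^ (n - s) :=
        mul_le_mul_of_nonneg_right h1 h2
    _ = ((Real.sqrt 2)⁻¹) ^ (n - s) := one_mul _

/-- The pull-back never increases `|Φ|` (`0 ≤ ρ_k ≤ 1`). [cite: AaronsonAmbainis2018, §3.2] -/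
theorem abs_kForrelationValue_comp_embedding_le (e : Fin s ↪ Fin n) (g : Fin k → (Fin s → Bool) → Bool) :
    |kForrelationValue (fun i x => g i (fun j => x (e j)))| ≤ |kForrelationValue g| := by
  rw [kForrelationValue_comp_embedding, abs_mul, abs_pow, abs_of_nonneg (idleFactor_nonneg k)]
  exact mul_le_of_le_one_right (abs_nonneg _) (pow_le_one₀ (idleFactor_nonneg k) (idleFactor_le_one k))

/-- **Two layouts of the same read restrictions, odd `k`**: the pull-backs of `g` along any two
embeddings `Fin s ↪ Fin n`, `Fin s ↪ Fin m` have the same `Φ`. [cite: AaronsonAmbainis2018, §3.2] -/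
theorem kForrelationValue_comp_embedding_eq_of_odd {m : ℕ} (hk : k % 2 = 1) (e : Fin s ↪ Fin n) (e' : Fin s ↪ Fin m)
    (g : Fin k → (Fin s → Bool) → Bool) :
    kForrelationValue (fun i x => g i (fun j => x (e j))) = kForrelationValue (fun i x => g i (fun j => x (e' j))) := by
  rw [kForrelationValue_comp_embedding_of_odd hk, kForrelationValue_comp_embedding_of_odd hk]

/-- `(1/√2)^d ≤ 1/16` as soon as `d ≥ 8`. [folklore] -/
theorem sqrt_two_inv_pow_le_sixteenth {d : ℕ} (hd : 8 ≤ d) : ((Real.sqrt 2)⁻¹) ^ d ≤ (1 : ℝ) / 16 := by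
  have h0 : 0 ≤ (Real.sqrt 2)⁻¹ := inv_nonneg.2 (Real.sqrt_nonneg 2)
  have h1 : (Real.sqrt 2)⁻¹ ≤ 1 := inv_le_one_of_one_le₀ (Real.one_le_sqrt.2 (by norm_num))
  have h8 : ((Real.sqrt 2)⁻¹) ^ 8 = 1 / 16 := by
    rw [show (8 : ℕ) = 2 * 4 by norm_num, pow_mul, inv_pow, Real.sq_sqrt (by norm_num : (0:ℝ) ≤ 2)]
    norm_num
  calc ((Real.sqrt 2)⁻¹) ^ d ≤ ((Real.sqrt 2)⁻¹) ^ 8 := pow_le_pow_of_le_one h0 h1 hd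
    _ = 1 / 16 := h8

/-- `(1/√2)^d < 3/5` as soon as `d ≥ 2`. [folklore] -/
theorem sqrt_two_inv_pow_lt {d : ℕ} (hd : 2 ≤ d) : ((Real.sqrt 2)⁻¹) ^ d < (3 : ℝ) / 5 := by
  have h0 : 0 ≤ (Real.sqrt 2)⁻¹ := inv_nonneg.2 (Real.sqrt_nonneg 2)
  have h1 : (Real.sqrt 2)⁻¹ ≤ 1 := inv_le_one_of_one_le₀ (Real.one_le_sqrt.2 (by norm_num))
  have h2 : ((Real.sqrt 2)⁻¹) ^ 2 = 1 / 2 := by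
    rw [inv_pow, Real.sq_sqrt (by norm_num : (0:ℝ) ≤ 2)]; norm_num
  calc ((Real.sqrt 2)⁻¹) ^ d ≤ ((Real.sqrt 2)⁻¹) ^ 2 := pow_le_pow_of_le_one h0 h1 hd
    _ = 1 / 2 := h2
    _ < 3 / 5 := by norm_num


/-! ### Read restrictions -/

section ReadRestrict

variable {ι : Type*}

/-- **The read restriction** of a function `F` on `n` bits along an embedding `e : Fin s ↪ Fin n`:
the function of `s` bits obtained by placing them at `e` and zeros elsewhere. [cite: AaronsonAmbainis2018, §6 (p. 26)] -/
def readRestrict (e : Fin s ↪ Fin n) (F : (Fin n → Bool) → Bool) : (Fin s → Bool) → Bool :=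
  fun z => F fun l => if h : ∃ j, e j = l then z (Classical.choose h) else false

/-- **A function that reads only the range of `e` factors through its read restriction**:
`F x = (readRestrict e F) (x ∘ e)`. [cite: AaronsonAmbainis2018, §6 (p. 26)] -/
theorem eq_readRestrict_comp (e : Fin s ↪ Fin n) (F : (Fin n → Bool) → Bool)
    (hF : ∀ x x' : Fin n → Bool, (∀ j, x (e j) = x' (e j)) → F x = F x') (x : Fin n → Bool) :
    F x = readRestrict e F (fun j => x (e j)) := by
  unfold readRestrict
  refine hF x _ fun j => ?_
  have h : ∃ j', e j' = e j := ⟨j, rfl⟩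
  rw [dif_pos h]
  show x (e j) = x (e (Classical.choose h))
  rw [Classical.choose_spec h]

/-- For a circuit: if `C` reads only coordinates in the range of `e`, then
`C.eval x = (readRestrict e C.eval) (x ∘ e)`. [cite: AaronsonAmbainis2018, §6 (p. 26)] -/
theorem Circuit.eval_eq_readRestrict (e : Fin s ↪ Fin n) (C : Circuit (Fin n))
    (hC : ∀ i ∈ C.readSet, ∃ j, e j = i) (x : Fin n → Bool) :
    C.eval x = readRestrict e C.eval (fun j => x (e j)) := by
  refine eq_readRestrict_comp e C.eval (fun x x' hxx' => C.eval_congr_readSet fun i hi => ?_) x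
  obtain ⟨j, rfl⟩ := hC i hi
  exact hxx' j

/-- **`Φ` of an instance through its read restrictions.** If every circuit of `f₀,…,f_{k-1}`
(functions on `n` bits) reads only coordinates in the range of `e : Fin s ↪ Fin n`, then
`Φ_f = Φ_g · ρ_k^{n-s}` for the read restrictions `g`. [cite: AaronsonAmbainis2018, §3.2 and §6 (p. 26)] -/
theorem kForrelationValue_eq_readRestrict (e : Fin s ↪ Fin n) (F : Fin k → (Fin n → Bool) → Bool)
    (hF : ∀ i (x x' : Fin n → Bool), (∀ j, x (e j) = x' (e j)) → F i x = F i x') :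
    kForrelationValue F = kForrelationValue (fun i => readRestrict e (F i)) * idleFactor k ^ (n - s) := by
  rw [← kForrelationValue_comp_embedding e]
  congr 1
  funext i x
  exact eq_readRestrict_comp e (F i) (hF i) x

/-- **Two layouts.** If `F` on `n` bits and `F'` on `m` bits both factor through the same read
restrictions `g` along embeddings `e`, `e'` (`F i x = g i (x ∘ e)`, `F' i y = g i (y ∘ e')`), then
`Φ_F · ρ^{m-s} = Φ_{F'} · ρ^{n-s}`; in particular they agree for odd `k`. [cite: AaronsonAmbainis2018, §3.2] -/
theorem kForrelationValue_layout {m : ℕ} (e : Fin s ↪ Fin n) (e' : Fin s ↪ Fin m) (g : Fin k → (Fin s → Bool) → Bool)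
    (F : Fin k → (Fin n → Bool) → Bool) (F' : Fin k → (Fin m → Bool) → Bool)
    (hF : ∀ i x, F i x = g i (fun j => x (e j))) (hF' : ∀ i y, F' i y = g i (fun j => y (e' j))) :
    kForrelationValue F * idleFactor k ^ (m - s) = kForrelationValue F' * idleFactor k ^ (n - s) := by
  have h1 : F = fun i x => g i (fun j => x (e j)) := by funext i x; exact hF i x
  have h2 : F' = fun i y => g i (fun j => y (e' j)) := by funext i y; exact hF' i y
  rw [h1, h2, kForrelationValue_comp_embedding, kForrelationValue_comp_embedding]
  ring

end ReadRestrict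


end Literature.Computability.QuantumComplexity

end
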